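import Summits.ResolutionOfSingularities.ResolutionOfSingularities.Theorems.FrobeniusLadderFInjectiveMacaulayficationFilteredChartClause
import Summits.ResolutionOfSingularities.ResolutionOfSingularities.Theorems.FrobeniusLadderFInjectiveMacaulayficationWeightedConeCore
import HarnessLib

/-!
# G5♮ — THE FILTERED ENGINE `FilteredConeFiModel`, LANDED (core p460946 ∘ G4♮ p492625)
# (crux `FInjectiveMacaulayfication`, line `graded-engine` §17; statement = `L/w45a/FilteredEngineSig.lean` 38fcb53793719719 /
# skeleton v14 `filteredConeFiModel_of_filteredChartClause` VERBATIM)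

Support file for crux stmt-ResolutionOfSingularities-15315 (`FrobeniusLadder.FInjectiveMacaulayfication`), chain w45a,
seat res-L1-w45a-stub-3 (owner of the G5♮ consumers S1 / g-tail / G5w; lead-1 03:43:22Z: «landing file = whoever owns the G5♮
consumer»). [OURS · L1 W4.5a] — NOT a statement of the manuscript; AI-written, weaker than expert review.

* `filteredConeFiModel` — **G5♮**: for weights `w` with `N = c_v·w_v` and Veronese saturation, an ARBITRARY prime hypersurface `f`
  with initial `w`-form `f₀ ≠ 0` of weight `D`, all `x̄ⱼ ≠ 0`, the clause for `k[X]/(f)` off `V(X)` (hoff) and for the weighted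
  tangent cone `k[X]/(f₀)` off the origin (hoff₀) ⟹ the weighted blow-up of `Spec k[X]/(f)` along `I_N` is an F-injective
  Macaulayfication (proper, birational, stalks domains, every s.o.p. weakly regular with Frobenius-closed ideal). Proof = lead-1's
  skeleton term: `WeightedConeCore.weightedConeFiModel_of_chartClause` fed with G4♮ `FilteredChartClause.stub_filteredChartClause`.

No definitions, no named facts. [folklore mechanism: deformation to the weighted tangent cone]
-/

-- single-problem summit: the doubled namespace component is forced
set_option linter.dupNamespace false

noncomputable section

open AlgebraicGeometry CategoryTheory

namespace Summit.ResolutionOfSingularities.ResolutionOfSingularities.Theorems.FInjectiveMacaulayfication.FilteredConeFiModel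

open Summit.ResolutionOfSingularities.ResolutionOfSingularities.Theorems.FInjectiveMacaulayfication

/-- [OURS · L1 W4.5a] **G5♮ — THE FILTERED ENGINE, PROVED** (statement verbatim from `FilteredEngineSig.lean` / skeleton v14): `f` arbitrary, `(f)` prime, all `x̄_v ≠ 0`,
`f₀` its initial `w`-form, `N = c_v·w_v` for all `v`, Veronese saturation; if `R = k[X]/(f)` satisfies the clause at the closed points off
`V(X₁,…,Xₙ)` (hoff) AND the initial cone `k[X]/(f₀)` satisfies it off the origin (hoff₀), then the weighted blow-up of `Spec R` along `I_N R`
is an F-injective Macaulayfication of `Spec R` — every `p`, no chart hypotheses (core p460946 ∘ G4♮). This is the engine that certifies ONE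
weighted blow-up at a NON-quasi-homogeneous isolated point from data of its weighted tangent cone. -/
theorem filteredConeFiModel : ∀ (p : ℕ) [Fact p.Prime] (k : Type) [Field k] [CharP k p] (n : ℕ) (w : Fin n → ℕ)
    (N D : ℕ) (c : Fin n → ℕ), 0 < N → (∀ v : Fin n, 0 < w v ∧ c v * w v = N) →
    (∀ (K : ℕ) (b : Fin n →₀ ℕ), K * N ≤ Finsupp.weight w b → (MvPolynomial.monomial b (1 : k) : MvPolynomial (Fin n) k) ∈
      (Ideal.span {m : MvPolynomial (Fin n) k | ∃ b : Fin n →₀ ℕ, N ≤ Finsupp.weight w b ∧ m = MvPolynomial.monomial b 1}) ^ K) →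
    ∀ (f f₀ : MvPolynomial (Fin n) k), f₀ = MvPolynomial.weightedHomogeneousComponent w D f →
    (∀ m < D, MvPolynomial.weightedHomogeneousComponent w m f = 0) → f₀ ≠ 0 → (Ideal.span {f}).IsPrime →
    (∀ v : Fin n, Ideal.Quotient.mk (Ideal.span {f}) (MvPolynomial.X v) ≠ 0) →
    (∀ (Q : Ideal (MvPolynomial (Fin n) k ⧸ Ideal.span {f})) [Q.IsMaximal],
      (∃ j : Fin n, Ideal.Quotient.mk (Ideal.span {f}) (MvPolynomial.X j) ∉ Q) →
      ∀ d : ℕ, ringKrullDim (Localization.AtPrime Q) = d → ∀ s : Fin d → Localization.AtPrime Q,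
        (Ideal.span (Set.range s)).radical.IsMaximal →
          RingTheory.Sequence.IsWeaklyRegular (Localization.AtPrime Q) (List.ofFn s) ∧
          ∀ y : Localization.AtPrime Q, (∃ e : ℕ, y ^ p ^ e ∈ Ideal.span
            ((fun z : Localization.AtPrime Q => z ^ p ^ e) ''
              (Ideal.span (Set.range s) : Set (Localization.AtPrime Q)))) → y ∈ Ideal.span (Set.range s)) →
    (∀ (Q : Ideal (MvPolynomial (Fin n) k ⧸ Ideal.span {f₀})) [Q.IsMaximal],
      (∃ j : Fin n, Ideal.Quotient.mk (Ideal.span {f₀}) (MvPolynomial.X j) ∉ Q) →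
      ∀ d : ℕ, ringKrullDim (Localization.AtPrime Q) = d → ∀ s : Fin d → Localization.AtPrime Q,
        (Ideal.span (Set.range s)).radical.IsMaximal →
          RingTheory.Sequence.IsWeaklyRegular (Localization.AtPrime Q) (List.ofFn s) ∧
          ∀ y : Localization.AtPrime Q, (∃ e : ℕ, y ^ p ^ e ∈ Ideal.span
            ((fun z : Localization.AtPrime Q => z ^ p ^ e) ''
              (Ideal.span (Set.range s) : Set (Localization.AtPrime Q)))) → y ∈ Ideal.span (Set.range s)) →
    ∃ (X' : Scheme.{0}) (π : X' ⟶ Spec (.of (MvPolynomial (Fin n) k ⧸ Ideal.span {f}))), IsProper π ∧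
      Literature.AlgebraicGeometry.Resolution.IsBirational π ∧
      ∀ y : X', IsDomain (X'.presheaf.stalk y) ∧ ∀ d : ℕ, ringKrullDim (X'.presheaf.stalk y) = d →
        ∀ s : Fin d → X'.presheaf.stalk y, (Ideal.span (Set.range s)).radical.IsMaximal →
          RingTheory.Sequence.IsWeaklyRegular (X'.presheaf.stalk y) (List.ofFn s) ∧
          ∀ z : X'.presheaf.stalk y, (∃ e : ℕ, z ^ p ^ e ∈
              Ideal.span ((fun w : X'.presheaf.stalk y => w ^ p ^ e) ''
                (Ideal.span (Set.range s) : Set (X'.presheaf.stalk y)))) →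
            z ∈ Ideal.span (Set.range s) := by
  intro p _ k _ _ n w N D c hN hwc hpow f f₀ hf₀ hD0 hD hfprime hXne hoff hoff₀
  have hc : ∀ j : Fin n, 0 < c j := fun j => Nat.pos_of_ne_zero fun h => by
    have h2 := (hwc j).2
    rw [h, zero_mul] at h2
    omega
  exact WeightedConeCore.weightedConeFiModel_of_chartClause p k n w N c hN hwc hpow f hfprime hXne hoff
    (fun v Q _ hQ => FilteredChartClause.stub_filteredChartClause p k n w v (hwc v).1 N (c v) D (hwc v).2 (hc v) hpow f f₀ hf₀ hD0 hD hfprime hXne hoff₀ Q hQ)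


end Summit.ResolutionOfSingularities.ResolutionOfSingularities.Theorems.FInjectiveMacaulayfication.FilteredConeFiModel

end
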